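import Summits.CriticalPhenomena.SAWScalingLimit.Theses.SAWExpectedSignature
import Literature.Probability.RandomPlanarGeometry.SLEExistenceNeEightHolds
import Literature.Probability.RandomPlanarGeometry.CritPercSLESimplePathHolds
import Literature.Probability.RandomPlanarGeometry.CaratheodoryHalfPlaneProofs
import Literature.Probability.RandomPlanarGeometry.LocalMartingaleProofs
import Literature.Probability.RandomPlanarGeometry.ConformalRestrictionProofs
import Literature.Probability.RandomPlanarGeometry.SimpleCurves
import HarnessLib.Audit

/-!
# Birth skeleton — piece `SimpleLawFromSigLaw` (support) of the split of crux `MomentsIdentifySLE` (stmt-CriticalPhenomena-5888)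

§0 of this file is `Cruxes/MomentsIdentifySLE/Split.lean` VERBATIM (the three piece `def`s and the proved
assembly `MomentsIdentifySLE_of_subs`): crux work-files are not built as importable modules on the farm, so a
skeleton that must conclude the piece BY NAME re-declares the pieces in their own namespace instead of importing
them. §1 is the skeleton proper.

§1. PROVED here: `sleSimplePinned` — a chordal SLE(8/3) law of `D` is a probability law carried by SIMPLE classes
issued from `a = D.pt 0` (tree: `IsSLELaw.isProbabilityMeasure` + `isProjectiveLimit_preWienerMeasure_holds`,
`IsSLELaw.ae_simple` + `ae_isSimpleTrace_sleTrace_of_le_four_holds` (Rohde–Schramm Thm 6.1) +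
`CurveClass.measurableSet_simple_holds`, `IsSLELaw.ae_endpoints` + `JordanDomain.mapsTo_boundaryExtension_holds`),
and the null-set bookkeeping `measure_compl_strata_null`. Three registered stubs:
* `stub_coeffMeasurable` (analytic preliminaries, size M): `x ↦ V_r(rep x)` is Borel (a reparametrisation-
  invariant lower-semicontinuous class function); the stratum `A_z = simple ∩ {source = z} ∩ {∃ r < 2, V_r < ∞}`
  is Borel; every signature coefficient RESTRICTED to `A_z` is Borel (Lyons–Young continuity of the Young
  signature on the closed strata `{V_r ≤ K}`; off `⋃_r {V_r < ∞}` the inline coefficient is a junk limit of a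
  choice representative, so global measurability is neither claimed nor needed).
* `stub_sigInjOn` (uniqueness of signature for simple curves, size L–XL): on `A_z` the full coefficient family
  `(S_w)_w` is injective — Boedihardjo–Geng–Lyons–Yang, Adv. Math. 293 (2016), Thm 1.1 (the signature determines a
  weakly geometric rough path up to tree-like equivalence; a simple curve is tree-reduced) and Boedihardjo–Ni–Qian,
  J. Funct. Anal. 267 (2014) (planar simple curves); the pin `source = z` removes the translation ambiguity,
  the quotient `CurveClass` the reparametrisation.
* `stub_measure_eq_of_injOn` (descriptive measure theory, size M): two probability laws concentrated on a Borel
  set on which a countable family of Borel real functions is injective, with equal joint laws of all finite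
  subfamilies (bounded continuous test functions), are EQUAL — π–λ on `ℝ^(List (Fin 2))` and Lusin–Souslin on the
  standard Borel space `CurveClass ℂ` (`Measurable.measurableEmbedding`; `CurveClass.instPolishSpace`).
`SimpleLawFromSigLaw_of` (no sorry) assembles them: both laws are concentrated on `A_a` (order-one moments +
`ae_lt_top`; `sleSimplePinned` on the SLE side, the hypotheses on the `ν` side), then transfer with
`f w x := S_w(rep x)`.
-/

namespace Summit.CriticalPhenomena.SAWScalingLimit.Cruxes.MomentsIdentifySLE.Split

open Summit.CriticalPhenomena.SAWScalingLimit.Theses.SAWExpectedSignature (MomentsIdentifySLE)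

open scoped BigOperators Topology Manifold Classical MeasureTheory ProbabilityTheory Matrix InnerProductSpace ComplexConjugate ContinuousMap
open Filter Set Function TopologicalSpace MeasureTheory

/-- piece 1 (crux): if every lattice expected-signature coefficient converges, the limits are the
expected signature of the chordal SLE(8/3) law of `(D; a, b)`, which is Young-regular. -/
def SigLimitIsSLE : Prop :=
  ∀ (D : Literature.Probability.RandomPlanarGeometry.DobrushinDomain) (a b : ℝ → Literature.Probability.LatticeModels.Site 2), Literature.Probability.RandomPlanarGeometry.SAW.IsEndpointApprox D a b → let pv : ℝ → Literature.Probability.RandomPlanarGeometry.Curve ℂ → ENNReal := fun p c => ⨆ π : ℕ × {u : ℕ → unitInterval // Monotone u}, ∑ i ∈ Finset.range π.1, edist (c (π.2.1 (i + 1))) (c (π.2.1 i)) ^ p; let sig : List (Fin 2) → Literature.Probability.RandomPlanarGeometry.Curve ℂ → ℝ := fun w c => limUnder Filter.atTop (fun n : ℕ => ∑ k ∈ (Finset.univ : Finset (Fin w.length → Fin (2 ^ n))).filter (fun k => StrictMono k), ∏ j : Fin w.length, (if w.get j = 0 then Complex.re else Complex.im) (c (Set.projIcc (0 : ℝ) 1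 zero_le_one ((((k j : ℕ) : ℝ) + 1) / 2 ^ n)) - c (Set.projIcc (0 : ℝ) 1 zero_le_one (((k j : ℕ) : ℝ) / 2 ^ n)))); let rep : Literature.Probability.RandomPlanarGeometry.CurveClass ℂ → Literature.Probability.RandomPlanarGeometry.Curve ℂ := fun x => (Literature.Probability.RandomPlanarGeometry.CurveClass.surjective_mk x).choose; let poly : (δ : ℝ) → Literature.Probability.RandomPlanarGeometry.SAW.DomainSAW D.carrier δ (a δ) (b δ) → Literature.Probability.RandomPlanarGeometry.Curve ℂ := fun δ γ => ⟨γ.walk.toCurve (Literature.Probability.LatticeModels.meshPoint δ)⟩; ∀ μ : MeasureTheory.Measure (Literature.Probability.RandomPlanarGeometry.CurveClass ℂ), Literature.Probability.RandomPlanarGeometry.IsSLELaw ((8 : NNReal) / 3) D μ → ∀ s : List (Fin 2) → ℝ, (∀ w : List (Fin 2), Filter.Tendsto (fun δ => ∫ γ, sig w (poly δ γ) ∂(Literature.Probability.RandomPlanarGeometry.SAW.law D.carrier δ (a δ) (b δ))) (nhdsWithin 0 (Set.Ioi 0)) (nhds (s w))) → ∃ q : ℝ, 1 ≤ q ∧ q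 < 2 ∧ (∀ n : ℕ, ∫⁻ x, pv q (rep x) ^ (n : ℝ) ∂μ ≠ ⊤) ∧ ∀ w : List (Fin 2), MeasureTheory.Integrable (fun x => sig w (rep x)) μ ∧ ∫ x, sig w (rep x) ∂μ = s w

/-- piece 2 (crux): expected-signature determinacy anchored at a Young-regular SLE(8/3) law — equal
expected signatures (with finite variation moments of all orders on both sides) force equal joint laws of
the signature coefficients. -/
def SLESigDeterminacy : Prop :=
  ∀ (D : Literature.Probability.RandomPlanarGeometry.DobrushinDomain), let pv : ℝ → Literature.Probability.RandomPlanarGeometry.Curve ℂ → ENNReal := fun p c => ⨆ π : ℕ × {u : ℕ → unitInterval // Monotone u}, ∑ i ∈ Finset.range π.1, edist (c (π.2.1 (i + 1))) (c (π.2.1 i)) ^ p; let sig : List (Fin 2) → Literature.Probability.RandomPlanarGeometry.Curve ℂ → ℝ := fun w c => limUnder Filter.atTop (fun n : ℕ => ∑ k ∈ (Finset.univ : Finset (Fin w.length → Fin (2 ^ n))).filter (fun k => StrictMono k), ∏ j : Fin w.length, (if w.get j = 0 then Complex.re else Complex.im) (c (Set.projIcc (0 : ℝ) 1 zero_le_one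 ((((k j : ℕ) : ℝ) + 1) / 2 ^ n)) - c (Set.projIcc (0 : ℝ) 1 zero_le_one (((k j : ℕ) : ℝ) / 2 ^ n)))); let rep : Literature.Probability.RandomPlanarGeometry.CurveClass ℂ → Literature.Probability.RandomPlanarGeometry.Curve ℂ := fun x => (Literature.Probability.RandomPlanarGeometry.CurveClass.surjective_mk x).choose; ∀ (p q : ℝ), 1 ≤ p → p < 2 → 1 ≤ q → q < 2 → ∀ μ ν : MeasureTheory.Measure (Literature.Probability.RandomPlanarGeometry.CurveClass ℂ), Literature.Probability.RandomPlanarGeometry.IsSLELaw ((8 : NNReal) / 3) D μ → MeasureTheory.IsProbabilityMeasure ν → (∀ n : ℕ, ∫⁻ x, pv q (rep x) ^ (n : ℝ) ∂μ ≠ ⊤) → (∀ n : ℕ, ∫⁻ x, pv p (rep x) ^ (n : ℝ) ∂ν ≠ ⊤) → (∀ w : List (Fin 2), MeasureTheory.Integrable (fun x => sig w (rep x)) μ ∧ MeasureTheory.Integrable (fun x => sig w (rep x)) ν ∧ ∫ x, sig w (rep x) ∂ν = ∫ x, sig w (rep x) ∂μ) → ∀ (ws : List (List (Fin 2))) (F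 : BoundedContinuousFunction (Fin ws.length → ℝ) ℝ), ∫ x, F (fun i => sig (ws.get i) (rep x)) ∂ν = ∫ x, F (fun i => sig (ws.get i) (rep x)) ∂μ

/-- piece 3 (support): a simple law pinned at `a = D.pt 0` with finite variation moments whose signature
coefficients have the same joint law as under a Young-regular SLE(8/3) law of `D` is that law. -/
def SimpleLawFromSigLaw : Prop :=
  ∀ (D : Literature.Probability.RandomPlanarGeometry.DobrushinDomain), let pv : ℝ → Literature.Probability.RandomPlanarGeometry.Curve ℂ → ENNReal := fun p c => ⨆ π : ℕ × {u : ℕ → unitInterval // Monotone u}, ∑ i ∈ Finset.range π.1, edist (c (π.2.1 (i + 1))) (c (π.2.1 i)) ^ p; let sig : List (Fin 2) → Literature.Probability.RandomPlanarGeometry.Curve ℂ → ℝ := fun w c => limUnder Filter.atTop (fun n : ℕ => ∑ k ∈ (Finset.univ : Finset (Fin w.length → Fin (2 ^ n))).filter (fun k => StrictMono k), ∏ j : Fin w.length, (if w.get j = 0 then Complex.re else Complex.im) (c (Set.projIcc (0 : ℝ) 1 zero_le_one ((((k j : ℕ) : ℝ) + 1) / 2 ^ n)) - c (Set.projIcc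 (0 : ℝ) 1 zero_le_one (((k j : ℕ) : ℝ) / 2 ^ n)))); let rep : Literature.Probability.RandomPlanarGeometry.CurveClass ℂ → Literature.Probability.RandomPlanarGeometry.Curve ℂ := fun x => (Literature.Probability.RandomPlanarGeometry.CurveClass.surjective_mk x).choose; ∀ (p q : ℝ), 1 ≤ p → p < 2 → 1 ≤ q → q < 2 → ∀ μ ν : MeasureTheory.Measure (Literature.Probability.RandomPlanarGeometry.CurveClass ℂ), Literature.Probability.RandomPlanarGeometry.IsSLELaw ((8 : NNReal) / 3) D μ → MeasureTheory.IsProbabilityMeasure ν → (∀ n : ℕ, ∫⁻ x, pv q (rep x) ^ (n : ℝ) ∂μ ≠ ⊤) → (∀ n : ℕ, ∫⁻ x, pv p (rep x) ^ (n : ℝ) ∂ν ≠ ⊤) → ν (Literature.Probability.RandomPlanarGeometry.CurveClass.simple)ᶜ = 0 → ν {x | x.source ≠ D.pt 0} = 0 → (∀ (ws : List (List (Fin 2))) (F : BoundedContinuousFunction (Fin ws.length → ℝ) ℝ), ∫ x, F (fun i => sig (ws.get i) (rep x)) ∂ν = ∫ x, F (fun i => sig (ws.get i) (rep x)) ∂μ)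 → ν = μ

/-- ASSEMBLY of the split: the three pieces imply the crux `MomentsIdentifySLE` by name. -/
theorem MomentsIdentifySLE_of_subs :
    SigLimitIsSLE → SLESigDeterminacy → SimpleLawFromSigLaw → MomentsIdentifySLE := by
  intro h1 h2 h3 D a b hab
  dsimp only
  intro p hp1 hp2 ν hν hmom hsimp hsrc hsig
  -- the chordal SLE(8/3) law `μ` of `D` exists (Rohde–Schramm Thm 5.1 / 7.1, proved in the tree)
  obtain ⟨μ, hμ⟩ :=
    Literature.Probability.RandomPlanarGeometry.exists_isSLELaw_of_ne_eight (κ := (8 : NNReal) / 3)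
      (by positivity) (by norm_num) D
  -- piece 1, fed with the lattice limits carried by `ν` (hypothesis (iv)): `μ` is Young-regular with
  -- exponent `q`, its signature coefficients are integrable and their expectations are those limits
  have h1' := h1 D a b hab
  dsimp only at h1'
  obtain ⟨q, hq1, hq2, hmomμ, hS⟩ := h1' μ hμ _ (fun w => (hsig w).2)
  -- piece 2: the joint laws of the signature coefficients under `ν` and `μ` agree
  have h2' := h2 D
  dsimp only at h2'
  have hlaw := h2' p q hp1 hp2 hq1 hq2 μ ν hμ hν hmomμ hmom
    (fun w => ⟨(hS w).1, (hsig w).1, (hS w).2.symm⟩)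
  -- piece 3: a simple pinned finite-moment law with the SLE signature law is the SLE law
  have h3' := h3 D
  dsimp only at h3'
  have hνμ : ν = μ := h3' p q hp1 hp2 hq1 hq2 μ ν hμ hν hmomμ hmom hsimp hsrc hlaw
  rw [hνμ]
  exact hμ

end Summit.CriticalPhenomena.SAWScalingLimit.Cruxes.MomentsIdentifySLE.Split

namespace Summit.CriticalPhenomena.SAWScalingLimit.Cruxes.MomentsIdentifySLE.Birth.SimpleLawFromSigLaw

open Summit.CriticalPhenomena.SAWScalingLimit.Cruxes.MomentsIdentifySLE.Split
open scoped BigOperators Topology Classical MeasureTheory ProbabilityTheory ENNReal NNReal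
open Filter Set Function TopologicalSpace MeasureTheory

/-- PROVED (tree facts): a chordal SLE(8/3) law of `D` is a probability law carried by simple classes issued
from `a = D.pt 0` (Rohde–Schramm 2005, Thm 6.1; Lawler 2005, §6.3). -/
theorem sleSimplePinned (D : Literature.Probability.RandomPlanarGeometry.DobrushinDomain) (μ : MeasureTheory.Measure (Literature.Probability.RandomPlanarGeometry.CurveClass ℂ))
    (hμ : Literature.Probability.RandomPlanarGeometry.IsSLELaw ((8 : NNReal) / 3) D μ) :
    MeasureTheory.IsProbabilityMeasure μ ∧ μ (Literature.Probability.RandomPlanarGeometry.CurveClass.simple)ᶜ = 0 ∧ μ {x | x.source ≠ D.pt 0} = 0 := by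
  haveI : Fact Literature.Probability.Process.isProjectiveLimit_preWienerMeasure :=
    ⟨Literature.Probability.RandomPlanarGeometry.isProjectiveLimit_preWienerMeasure_holds⟩
  have hκ0 : (0 : NNReal) < 8 / 3 := by positivity
  have hκ4 : (8 : NNReal) / 3 ≤ 4 := by
    rw [div_le_iff₀ (by norm_num : (0 : NNReal) < 3)]; norm_num
  refine ⟨hμ.isProbabilityMeasure, ?_, ?_⟩
  · have h := hμ.ae_simple Literature.Probability.RandomPlanarGeometry.ae_isSimpleTrace_sleTrace_of_le_four_holds
      Literature.Probability.RandomPlanarGeometry.CurveClass.measurableSet_simple_holds hκ0 hκ4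
    exact mem_ae_iff.1 (Filter.eventually_mem_set.1 (h.mono fun γ hγ => hγ.1))
  · have h := hμ.ae_endpoints Literature.Probability.RandomPlanarGeometry.JordanDomain.mapsTo_boundaryExtension_holds
    exact ae_iff.1 (h.mono fun γ hγ => hγ.1)

/-- Null-set bookkeeping (pure measure theory): a law carried by `S`, pinned at `z` and a.e. of finite
`r`-variation for one `r ∈ [1, 2)` gives full measure to the stratum
`S ∩ {src = z} ∩ {∃ r ∈ [1,2), V_r ≠ ⊤}`. [folklore] -/
theorem measure_compl_strata_null {X : Type*} [MeasurableSpace X] (ρ : MeasureTheory.Measure X) {S : Set X}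
    {src : X → ℂ} {z : ℂ} (V : ℝ → X → ℝ≥0∞) {r : ℝ} (hr1 : 1 ≤ r) (hr2 : r < 2)
    (hS : ρ Sᶜ = 0) (hP : ρ {x | src x ≠ z} = 0) (hR : ∀ᵐ x ∂ρ, V r x < ⊤) :
    ρ {x | x ∈ S ∧ src x = z ∧ ∃ r : ℝ, 1 ≤ r ∧ r < 2 ∧ V r x ≠ ⊤}ᶜ = 0 := by
  have hS' : ∀ᵐ x ∂ρ, x ∈ S := Filter.eventually_mem_set.2 (mem_ae_iff.2 hS)
  have hP' : ∀ᵐ x ∂ρ, src x = z := by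
    rw [ae_iff]
    exact hP
  rw [← mem_ae_iff, ← Filter.eventually_mem_set]
  filter_upwards [hS', hP', hR] with x h1 h2 h3
  exact ⟨h1, h2, r, hr1, hr2, h3.ne⟩

/-- stub (analytic preliminaries) — measurability of the variation functional, of the strata
`A_z = simple ∩ {source = z} ∩ {∃ r < 2, V_r < ∞}`, and of every signature coefficient restricted to `A_z`
(lower semicontinuity of `V_r`; Lyons–Young continuity of the Young signature on `{V_r ≤ K}`). -/
theorem stub_coeffMeasurable :
    let pv : ℝ → Literature.Probability.RandomPlanarGeometry.Curve ℂ → ENNReal := fun p c => ⨆ π : ℕ × {u : ℕ → unitInterval // Monotone u}, ∑ i ∈ Finset.range π.1, edist (c (π.2.1 (i + 1))) (c (π.2.1 i)) ^ p; let sig : List (Fin 2) → Literature.Probability.RandomPlanarGeometry.Curve ℂ → ℝ := fun w c => limUnder Filter.atTop (fun n : ℕ => ∑ k ∈ (Finset.univ : Finset (Fin w.length → Fin (2 ^ n))).filter (fun k => StrictMono k), ∏ j : Fin w.length, (if w.get j = 0 then Complex.re else Complex.im) (c (Set.projIcc (0 : ℝ) 1 zero_le_one ((((k j : ℕ) : ℝ)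 + 1) / 2 ^ n)) - c (Set.projIcc (0 : ℝ) 1 zero_le_one (((k j : ℕ) : ℝ) / 2 ^ n)))); let rep : Literature.Probability.RandomPlanarGeometry.CurveClass ℂ → Literature.Probability.RandomPlanarGeometry.Curve ℂ := fun x => (Literature.Probability.RandomPlanarGeometry.CurveClass.surjective_mk x).choose; (∀ r : ℝ, 1 ≤ r → r < 2 → Measurable (fun x : Literature.Probability.RandomPlanarGeometry.CurveClass ℂ => pv r (rep x))) ∧ ∀ z : ℂ, MeasurableSet {x : Literature.Probability.RandomPlanarGeometry.CurveClass ℂ | x ∈ Literature.Probability.RandomPlanarGeometry.CurveClass.simple ∧ x.source = z ∧ ∃ r : ℝ, 1 ≤ r ∧ r < 2 ∧ pv r (rep x) ≠ ⊤} ∧ ∀ w : List (Fin 2), Measurable (Set.restrict {x : Literature.Probability.RandomPlanarGeometry.CurveClass ℂ | x ∈ Literature.Probability.RandomPlanarGeometry.CurveClass.simple ∧ x.source = z ∧ ∃ r : ℝ, 1 ≤ r ∧ r < 2 ∧ pv r (rep x) ≠ ⊤} (fun x => sig w (rep x))) := by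
  sorry

/-- stub (uniqueness of signature for simple curves) — on `A_z` the coefficient family `(S_w)_w` is injective
(Boedihardjo–Geng–Lyons–Yang 2016 Thm 1.1 + simple curves are tree-reduced; Boedihardjo–Ni–Qian 2014). -/
theorem stub_sigInjOn :
    let pv : ℝ → Literature.Probability.RandomPlanarGeometry.Curve ℂ → ENNReal := fun p c => ⨆ π : ℕ × {u : ℕ → unitInterval // Monotone u}, ∑ i ∈ Finset.range π.1, edist (c (π.2.1 (i + 1))) (c (π.2.1 i)) ^ p; let sig : List (Fin 2) → Literature.Probability.RandomPlanarGeometry.Curve ℂ → ℝ := fun w c => limUnder Filter.atTop (fun n : ℕ => ∑ k ∈ (Finset.univ : Finset (Fin w.length → Fin (2 ^ n))).filter (fun k => StrictMono k), ∏ j : Fin w.length, (if w.get j = 0 then Complex.re else Complex.im) (c (Set.projIcc (0 : ℝ) 1 zero_le_one ((((k j : ℕ) : ℝ) + 1) / 2 ^ n)) - c (Set.projIcc (0 : ℝ) 1 zero_le_one (((k j : ℕ) : ℝ) / 2 ^ n)))); let rep : Literature.Probability.RandomPlanarGeometry.CurveClass ℂ → Literature.Probability.RandomPlanarGeometry.Curve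 ℂ := fun x => (Literature.Probability.RandomPlanarGeometry.CurveClass.surjective_mk x).choose; ∀ z : ℂ, Set.InjOn (fun x : Literature.Probability.RandomPlanarGeometry.CurveClass ℂ => fun w : List (Fin 2) => sig w (rep x)) {x : Literature.Probability.RandomPlanarGeometry.CurveClass ℂ | x ∈ Literature.Probability.RandomPlanarGeometry.CurveClass.simple ∧ x.source = z ∧ ∃ r : ℝ, 1 ≤ r ∧ r < 2 ∧ pv r (rep x) ≠ ⊤} := by
  sorry

/-- stub (descriptive measure theory) — two probability laws concentrated on a Borel set where a countable
family of Borel real functions is injective, with equal finite-dimensional joint laws, coincide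
(π–λ + Lusin–Souslin on the standard Borel space `CurveClass ℂ`). -/
theorem stub_measure_eq_of_injOn :
    ∀ (f : List (Fin 2) → Literature.Probability.RandomPlanarGeometry.CurveClass ℂ → ℝ) (A : Set (Literature.Probability.RandomPlanarGeometry.CurveClass ℂ)), MeasurableSet A → (∀ w : List (Fin 2), Measurable (A.restrict (f w))) → Set.InjOn (fun x => fun w => f w x) A → ∀ μ ν : MeasureTheory.Measure (Literature.Probability.RandomPlanarGeometry.CurveClass ℂ), MeasureTheory.IsProbabilityMeasure μ → MeasureTheory.IsProbabilityMeasure ν → μ Aᶜ = 0 → ν Aᶜ = 0 → (∀ (ws : List (List (Fin 2))) (F : BoundedContinuousFunction (Fin ws.length → ℝ) ℝ), ∫ x, F (fun i => f (ws.get i) x) ∂ν = ∫ x, F (fun i => f (ws.get i) x) ∂μ) → ν = μ := by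
  sorry

/-- Composition: the three stubs (and the proved `sleSimplePinned`) give the piece `SimpleLawFromSigLaw`
by name. -/
theorem SimpleLawFromSigLaw_of :
    (let pv : ℝ → Literature.Probability.RandomPlanarGeometry.Curve ℂ → ENNReal := fun p c => ⨆ π : ℕ × {u : ℕ → unitInterval // Monotone u}, ∑ i ∈ Finset.range π.1, edist (c (π.2.1 (i + 1))) (c (π.2.1 i)) ^ p; let sig : List (Fin 2) → Literature.Probability.RandomPlanarGeometry.Curve ℂ → ℝ := fun w c => limUnder Filter.atTop (fun n : ℕ => ∑ k ∈ (Finset.univ : Finset (Fin w.length → Fin (2 ^ n))).filter (fun k => StrictMono k), ∏ j : Fin w.length, (if w.get j = 0 then Complex.re else Complex.im) (c (Set.projIcc (0 : ℝ) 1 zero_le_one ((((k j : ℕ) : ℝ) + 1) / 2 ^ n)) - c (Set.projIcc (0 : ℝ) 1 zero_le_one (((k j : ℕ) : ℝ) / 2 ^ n)))); let rep : Literature.Probability.RandomPlanarGeometry.CurveClass ℂ → Literature.Probability.RandomPlanarGeometry.Curve ℂ := fun x => (Literature.Probability.RandomPlanarGeometry.CurveClass.surjective_mk x).choose; (∀ r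 : ℝ, 1 ≤ r → r < 2 → Measurable (fun x : Literature.Probability.RandomPlanarGeometry.CurveClass ℂ => pv r (rep x))) ∧ ∀ z : ℂ, MeasurableSet {x : Literature.Probability.RandomPlanarGeometry.CurveClass ℂ | x ∈ Literature.Probability.RandomPlanarGeometry.CurveClass.simple ∧ x.source = z ∧ ∃ r : ℝ, 1 ≤ r ∧ r < 2 ∧ pv r (rep x) ≠ ⊤} ∧ ∀ w : List (Fin 2), Measurable (Set.restrict {x : Literature.Probability.RandomPlanarGeometry.CurveClass ℂ | x ∈ Literature.Probability.RandomPlanarGeometry.CurveClass.simple ∧ x.source = z ∧ ∃ r : ℝ, 1 ≤ r ∧ r < 2 ∧ pv r (rep x) ≠ ⊤} (fun x => sig w (rep x)))) →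
    (let pv : ℝ → Literature.Probability.RandomPlanarGeometry.Curve ℂ → ENNReal := fun p c => ⨆ π : ℕ × {u : ℕ → unitInterval // Monotone u}, ∑ i ∈ Finset.range π.1, edist (c (π.2.1 (i + 1))) (c (π.2.1 i)) ^ p; let sig : List (Fin 2) → Literature.Probability.RandomPlanarGeometry.Curve ℂ → ℝ := fun w c => limUnder Filter.atTop (fun n : ℕ => ∑ k ∈ (Finset.univ : Finset (Fin w.length → Fin (2 ^ n))).filter (fun k => StrictMono k), ∏ j : Fin w.length, (if w.get j = 0 then Complex.re else Complex.im) (c (Set.projIcc (0 : ℝ) 1 zero_le_one ((((k j : ℕ) : ℝ) + 1) / 2 ^ n)) - c (Set.projIcc (0 : ℝ) 1 zero_le_one (((k j : ℕ) : ℝ) / 2 ^ n)))); let rep : Literature.Probability.RandomPlanarGeometry.CurveClass ℂ → Literature.Probability.RandomPlanarGeometry.Curve ℂ := fun x => (Literature.Probability.RandomPlanarGeometry.CurveClass.surjective_mk x).choose; ∀ z : ℂ, Set.InjOn (fun x : Literature.Probability.RandomPlanarGeometry.CurveClass ℂ => fun w : List (Fin 2) => sig w (rep x)) {x : Literature.Probability.RandomPlanarGeometry.CurveClass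 ℂ | x ∈ Literature.Probability.RandomPlanarGeometry.CurveClass.simple ∧ x.source = z ∧ ∃ r : ℝ, 1 ≤ r ∧ r < 2 ∧ pv r (rep x) ≠ ⊤}) →
    (∀ (f : List (Fin 2) → Literature.Probability.RandomPlanarGeometry.CurveClass ℂ → ℝ) (A : Set (Literature.Probability.RandomPlanarGeometry.CurveClass ℂ)), MeasurableSet A → (∀ w : List (Fin 2), Measurable (A.restrict (f w))) → Set.InjOn (fun x => fun w => f w x) A → ∀ μ ν : MeasureTheory.Measure (Literature.Probability.RandomPlanarGeometry.CurveClass ℂ), MeasureTheory.IsProbabilityMeasure μ → MeasureTheory.IsProbabilityMeasure ν → μ Aᶜ = 0 → ν Aᶜ = 0 → (∀ (ws : List (List (Fin 2))) (F : BoundedContinuousFunction (Fin ws.length → ℝ) ℝ), ∫ x, F (fun i => f (ws.get i) x) ∂ν = ∫ x, F (fun i => f (ws.get i) x) ∂μ) → ν = μ) →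
    SimpleLawFromSigLaw := by
  intro hM hI hT D
  dsimp only
  intro p q hp1 hp2 hq1 hq2 μ ν hμ hν hmomμ hmomν hsimp hsrc hlaw
  dsimp only at hM hI
  obtain ⟨hpv, hA⟩ := hM
  obtain ⟨hμP, hμsimp, hμsrc⟩ := sleSimplePinned D μ hμ
  -- order-one variation moments: both laws are a.e. of finite variation
  have hmomμ1 := hmomμ 1
  have hmomν1 := hmomν 1
  simp only [Nat.cast_one, ENNReal.rpow_one] at hmomμ1 hmomν1
  have hfinμ := ae_lt_top (hpv q hq1 hq2) hmomμ1
  have hfinν := ae_lt_top (hpv p hp1 hp2) hmomν1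
  -- transfer along the injective coefficient map on the stratum `A_a`, `a = D.pt 0`
  refine hT _ _ (hA (D.pt 0)).1 (hA (D.pt 0)).2 (hI (D.pt 0)) μ ν hμP hν ?_ ?_ hlaw
  · exact measure_compl_strata_null μ _ hq1 hq2 hμsimp hμsrc hfinμ
  · exact measure_compl_strata_null ν _ hp1 hp2 hsimp hsrc hfinν

/-- The piece from its registered stubs. -/
theorem SimpleLawFromSigLaw_of_stubs : SimpleLawFromSigLaw :=
  SimpleLawFromSigLaw_of stub_coeffMeasurable stub_sigInjOn stub_measure_eq_of_injOn

end Summit.CriticalPhenomena.SAWScalingLimit.Cruxes.MomentsIdentifySLE.Birth.SimpleLawFromSigLaw
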